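import Mathlib
import HarnessLib
import Summits.ResolutionOfSingularities.ResolutionOfSingularities.Theorems.WildQuotientsWildQuotientResolutionToricExitCentre
import Summits.ResolutionOfSingularities.ResolutionOfSingularities.Theorems.WildQuotientsWildQuotientResolutionToricExitChartStable
import Summits.ResolutionOfSingularities.ResolutionOfSingularities.Theorems.WildQuotientsWildQuotientResolutionToricExitChartASections
import Summits.ResolutionOfSingularities.ResolutionOfSingularities.Theorems.WildQuotientsWildQuotientResolutionToricExitConeVertexIdeal
import Summits.ResolutionOfSingularities.ResolutionOfSingularities.Theorems.WildQuotientsWildQuotientResolutionToricExitConeVertexPresentation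
import Summits.ResolutionOfSingularities.ResolutionOfSingularities.Theorems.WildQuotientsWildQuotientResolutionJordanThreeConeBlowupRegular
import Summits.ResolutionOfSingularities.ResolutionOfSingularities.Theorems.WildQuotientsWildQuotientResolutionJordanThreeLaw
import Summits.ResolutionOfSingularities.ResolutionOfSingularities.Theorems.WildQuotientsWildQuotientResolutionJordanThreeOrderP
import Summits.ResolutionOfSingularities.ResolutionOfSingularities.Theorems.WildQuotientsWildQuotientResolutionGluedQuotientPieces
import Summits.ResolutionOfSingularities.ResolutionOfSingularities.Theorems.WildQuotientsWildQuotientResolutionBlowupLocalExitCharts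
import Summits.ResolutionOfSingularities.ResolutionOfSingularities.Theorems.WildQuotientsWildQuotientResolutionToricExitJordanThreeConeBrickPrelude
import Literature.AlgebraicGeometry.Resolution.BlowupsEquivariant
import Literature.AlgebraicGeometry.Resolution.NormalCrossingsLocal
import Literature.AlgebraicGeometry.Resolution.MvPolynomialKillVars

/-!
# V3U-F1, brick `HPa`: the cone brick of the J₃ toric exit

(crux stmt-ResolutionOfSingularities-15640 `WildQuotients.WildQuotientResolution`, line `Sketch`,
sector `|G| = p`; programme V3U of `L/w45c/CHAIN.md` v6.2 §4.0 row stub-3: the binder `HPa` of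
res-L1-w45c-lead-1's `ToricExit.jordanThree_hasResolution_of_bricks` (p496627), stated literally.
[OURS · L1 W4.5c] — NOT a statement of any manuscript; replaces the role of no printed item.)

`ToricExit.jordanThree_coneBrick`: for `V = Bl_{(x_a, x_b²)} 𝔸ⁿ` with the lifted `⟨σ⟩`-action
(`J₃` datum, `p ≥ 3`), the stable affine piece `Oa = V[x_a]` and the closed subset `Za ⊆ Oa/G`
equal to the image of the vertex locus `(π⁻¹V(x_a, x_b²) ∖ V[x_b²]) ∩ Oa`, EVERY blow-up of `Oa/G`
along the ideal sheaf of `Za` is regular. Assembly: `Oa/G ≅ Spec Γ(Oa)^G`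
(`BlowupExit.exists_iso_spec_pieceQuot`); `Γ(V, V[x_a]) ≅ E = k[ρ², ρβ, β², …]` with `π^* ↦ ψ₀`
(`exists_ringEquiv_blowupChart_adjoin`), under which `σ` acts by an endomorphism `τ` with
`τ ∘ ψ₀ = ψ₀ ∘ σ`, so the invariants are `k[coneGens]` (`fixedPoints_eq_of_rootSubst_law`, C0-equiv
by cancellation, on stub-1's C2); `k[coneGens] ≅ k[y]/(y_P y_R − y_Q²)` vertex ideal to vertex
ideal (`exists_coneQuotEquiv_map_vertex`, stub-4's C3), whose blow-up is regular (stub-4's C4); the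
point set through `mem_vertexLocus_iff`, `comap_inclusion_span_sq_eq` and integrality of the
invariants; transport (`BlowupExit.exists_isBlowup_regular_of_iso_spec`) and uniqueness of blow-ups.
-/

-- single-problem summit: the doubled namespace component `ResolutionOfSingularities` is forced
set_option linter.dupNamespace false

noncomputable section

open CategoryTheory AlgebraicGeometry TopologicalSpace MvPolynomial
open Literature.AlgebraicGeometry.Resolution Literature.AlgebraicGeometry.RelativeSpec

namespace Summit.ResolutionOfSingularities.ResolutionOfSingularities.Theorems.WildQuotientResolution.ToricExit

/-! ## The cone brick -/

set_option maxHeartbeats 4000000 in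
/-- **V3U-F1, brick `HPa` (the cone brick)**, literally the hypothesis `HPa` of
`ToricExit.jordanThree_hasResolution_of_bricks` (p496627): every blow-up of the quotient piece
`V[x_a]/G` of `V = Bl_{(x_a, x_b²)} 𝔸ⁿ` (lifted `⟨σ⟩`-action of the `J₃` datum, `p ≥ 3`) along the
ideal sheaf of the image of the vertex locus `π⁻¹V(x_a, x_b²) ∖ V[x_b²]` is regular. See the module
docstring for the assembly. [OURS · L1 W4.5c] [folklore; assembly of landed decls] -/
theorem jordanThree_coneBrick (p : ℕ) (hp : p.Prime) (hp3 : 3 ≤ p)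
    (k : Type) [Field k] [CharP k p] (n : ℕ)
    (σ : MvPolynomial (Fin n) k ≃ₐ[k] MvPolynomial (Fin n) k) [Finite ↥(Subgroup.zpowers σ)]
    (a b c : Fin n) (hab : a ≠ b) (hbc : b ≠ c) (hac : a ≠ c)
    (hb : σ (X b) = X b + X a) (hc : σ (X c) = X c + X b)
    (hσ : ∀ i, i ≠ b → i ≠ c → σ (X i) = X i)
    (ρ : ↥(Subgroup.zpowers σ) →* Aut (Spec (CommRingCat.of (MvPolynomial (Fin n) k))))
    (hρ : ∀ g : ↥(Subgroup.zpowers σ), (ρ g).hom = Spec.map (CommRingCat.ofHom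
      ((MulSemiringAction.toRingEquiv (↥(Subgroup.zpowers σ)) (MvPolynomial (Fin n) k) g⁻¹ :
        MvPolynomial (Fin n) k ≃+* MvPolynomial (Fin n) k) :
          MvPolynomial (Fin n) k →+* MvPolynomial (Fin n) k)))
    (ρB : ActionOver
      (affineBlowup.π (Ideal.span (Set.range (![X a, X b ^ 2] :
        Fin 2 → MvPolynomial (Fin n) k))) ≫
        Spec.map (CommRingCat.ofHom (algebraMap
          (FixedPoints.subalgebra k (MvPolynomial (Fin n) k) (Subgroup.zpowers σ))
          (MvPolynomial (Fin n) k))))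
      ↥(Subgroup.zpowers σ))
    (hρB : ρB.aut = (affineBlowup.isBlowup (Ideal.span (Set.range (![X a, X b ^ 2] :
        Fin 2 → MvPolynomial (Fin n) k)))).liftAction ρ
        (idealSheaf_centre_comap k n σ a b c hab hac hb hσ ρ hρ))
    (Oa : ρB.StableAffineOpens)
    (hOa : Oa.1 = blowupChart
      (affineBlowup.π (Ideal.span (Set.range (![X a, X b ^ 2] : Fin 2 → MvPolynomial (Fin n) k))))
      (affineBlowup.idealSheaf (Ideal.span (Set.range (![X a, X b ^ 2] :
        Fin 2 → MvPolynomial (Fin n) k))))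
      ⟨⊤, isAffineOpen_top _⟩
      ((Scheme.ΓSpecIso (CommRingCat.of (MvPolynomial (Fin n) k))).inv.hom (X a)))
    (Za : Closeds (ρB.pieceQuot Oa))
    (hZa : (Za : Set (ρB.pieceQuot Oa)) = (ρB.pieceMk Oa).base ''
      (Oa.1.ι.base ⁻¹'
        ({v | (affineBlowup.π (Ideal.span (Set.range (![X a, X b ^ 2] :
            Fin 2 → MvPolynomial (Fin n) k)))).base v ∈
            PrimeSpectrum.zeroLocus (Ideal.span (Set.range (![X a, X b ^ 2] :
              Fin 2 → MvPolynomial (Fin n) k)) : Set (MvPolynomial (Fin n) k))} \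
          (blowupChart
            (affineBlowup.π (Ideal.span (Set.range (![X a, X b ^ 2] :
              Fin 2 → MvPolynomial (Fin n) k))))
            (affineBlowup.idealSheaf (Ideal.span (Set.range (![X a, X b ^ 2] :
              Fin 2 → MvPolynomial (Fin n) k))))
            ⟨⊤, isAffineOpen_top _⟩
            ((Scheme.ΓSpecIso (CommRingCat.of (MvPolynomial (Fin n) k))).inv.hom (X b ^ 2)) :
              Set _))))
    (B' : Scheme.{0}) (pB : B' ⟶ ρB.pieceQuot Oa)
    (hpB : IsBlowup pB (Scheme.IdealSheafData.vanishingIdeal Za)) :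
    Scheme.IsRegular B' := by
  classical
  haveI : Fact (Nat.Prime p) := ⟨hp⟩
  have hba : b ≠ a := fun h => hab h.symm
  have ha : σ (X a) = X a := hσ a hab hac
  have hσp : σ ^ p = 1 := JordanThree.pow_prime_eq_one p hp hp3 k n σ a b c hab hac hb hc hσ
  have hfin : IsOfFinOrder σ := isOfFinOrder_iff_pow_eq_one.mpr ⟨p, hp.pos, hσp⟩
  -- the rings: `S = k[x]`, `G = ⟨σ⟩`, `A = S^G`, the even subalgebra `E` and the cone algebra `Ec`
  let S : Type := MvPolynomial (Fin n) k
  let G : Type := ↥(Subgroup.zpowers σ)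
  let A : Subalgebra k S := FixedPoints.subalgebra k S G
  let gσ : G := ⟨σ, Subgroup.mem_zpowers σ⟩
  have hGpow : ∀ g : G, ∃ m : ℕ, g = gσ ^ m := fun g => exists_pow_eq_of_isOfFinOrder σ hfin g
  have hgσ_smul : ∀ f : S, gσ • f = σ f := fun f => rfl
  let E : Subalgebra k S := Algebra.adjoin k (chartAGens k n a b)
  let Ec : Subalgebra k S := Algebra.adjoin k (coneGens k p n a b c)
  have hle : Ec ≤ E := adjoin_coneGens_le p hp hp3 k n a b c hab hbc hac
  let ψ₀ : S →ₐ[k] S :=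
    MvPolynomial.aeval (fun i => if i = a then X a ^ 2 else if i = b then X a * X b else (X i : S))
  have hψa : ψ₀ (X a) = X a ^ 2 := by
    change MvPolynomial.aeval _ (X a) = _
    rw [MvPolynomial.aeval_X, if_pos rfl]
  have hψb : ψ₀ (X b) = X a * X b := by
    change MvPolynomial.aeval _ (X b) = _
    rw [MvPolynomial.aeval_X, if_neg hba, if_pos rfl]
  -- the model `V = Bl_{(x_a, x_b²)} 𝔸ⁿ`, its map `π`, the lifted action
  let I₂ : Ideal S := Ideal.span (Set.range (![X a, X b ^ 2] : Fin 2 → S))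
  let q : Spec (.of S) ⟶ Spec (.of A) := Spec.map (CommRingCat.ofHom (algebraMap A S))
  have hπ : IsBlowup (affineBlowup.π I₂) (affineBlowup.idealSheaf I₂) := affineBlowup.isBlowup I₂
  have hJ : ∀ g : G, (affineBlowup.idealSheaf I₂).comap (ρ g).hom = affineBlowup.idealSheaf I₂ :=
    idealSheaf_centre_comap k n σ a b c hab hac hb hσ ρ hρ
  have hequiv : ∀ g : G, (hπ.liftAction ρ hJ g).hom ≫ affineBlowup.π I₂ =
      affineBlowup.π I₂ ≫ (ρ g).hom := fun g => hπ.liftAction_hom_comp ρ hJ g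
  let ι₀ : S →+* Γ(Spec (CommRingCat.of S), ⊤) := (Scheme.ΓSpecIso (CommRingCat.of S)).inv.hom
  have hIdeal : (affineBlowup.idealSheaf I₂).ideal ⟨⊤, isAffineOpen_top _⟩ = I₂.map ι₀ := by
    change (Scheme.IdealSheafData.ofIdealTop _).ideal ⟨⊤, isAffineOpen_top _⟩ = _
    rw [ideal_ofIdealTop_top]
  have hxa : ι₀ (X a) ∈ (affineBlowup.idealSheaf I₂).ideal ⟨⊤, isAffineOpen_top _⟩ := by
    rw [hIdeal]; exact Ideal.mem_map_of_mem _ (Ideal.subset_span ⟨0, rfl⟩)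
  have hxb : ι₀ (X b ^ 2) ∈ (affineBlowup.idealSheaf I₂).ideal ⟨⊤, isAffineOpen_top _⟩ := by
    rw [hIdeal]; exact Ideal.mem_map_of_mem _ (Ideal.subset_span ⟨1, rfl⟩)
  let chartA := blowupChart (affineBlowup.π I₂) (affineBlowup.idealSheaf I₂)
    ⟨⊤, isAffineOpen_top _⟩ (ι₀ (X a))
  let chartB := blowupChart (affineBlowup.π I₂) (affineBlowup.idealSheaf I₂)
    ⟨⊤, isAffineOpen_top _⟩ (ι₀ (X b ^ 2))
  have hO : IsAffineOpen chartA := hπ.isAffineOpen_blowupChart hxa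
  haveI : IsAffine (chartA : Scheme.{0}) := hO
  have hleπ : chartA ≤ affineBlowup.π I₂ ⁻¹ᵁ ((⟨⊤, isAffineOpen_top _⟩ :
      (Spec (CommRingCat.of S)).affineOpens) : (Spec (CommRingCat.of S)).Opens) :=
    blowupChart_le_preimage _ _ _ _
  obtain ⟨autB, hautB⟩ := ρB
  simp only at hρB
  subst hρB
  obtain ⟨O, hOst, hOaff⟩ := Oa
  simp only at hOa
  subst hOa
  let ρV : G →* Aut (affineBlowup I₂) := hπ.liftAction ρ hJ
  let ρB : ActionOver (affineBlowup.π I₂ ≫ q) G := ⟨ρV, hautB⟩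
  let Oa : ρB.StableAffineOpens := ⟨chartA, hOst, hOaff⟩
  have hA_st : ∀ g : G, (ρV g).hom ⁻¹ᵁ chartA = chartA := hOst
  let W : (chartA : Scheme.{0}).Opens := (chartA.ι ≫ (affineBlowup.π I₂ ≫ q)) ⁻¹ᵁ ⊤
  have hWtop : W = ⊤ := Scheme.Hom.preimage_top _
  have hWaff : IsAffineOpen W := by rw [hWtop]; exact isAffineOpen_top _
  let ρO := ρB.restrict chartA hOst
  let inv : Subring Γ(↑chartA, W) := ρO.invariantsRing ⊤
  -- ### (1) the piece `Oa/G` is `Spec` of the invariants of `R₀ = Γ(Oa, ⊤)`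
  obtain ⟨e, he⟩ := BlowupExit.exists_iso_spec_pieceQuot ρB Oa
  -- ### (2) the sections: `Γ(V, V[x_a]) ≅ R₀` and `≅ E`
  obtain ⟨ΘV, hΘV⟩ := exists_ringEquiv_blowupChart_adjoin k n a b hab
  have hVW : W ≤ chartA.ι ⁻¹ᵁ chartA := by rw [Scheme.Opens.ι_preimage_self]; exact le_top
  haveI hiso : IsIso (chartA.ι.appLE chartA W hVW) := by
    change IsIso (chartA.ι.appLE chartA ⊤ chartA.ι_preimage_self.ge)
    infer_instance
  let Θ₀ : Γ(affineBlowup I₂, chartA) ≃+* Γ(↑chartA, W) :=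
    (asIso (chartA.ι.appLE chartA W hVW)).commRingCatIsoToRingEquiv
  have hΘ₀ : ∀ s, Θ₀ s = (chartA.ι.appLE chartA W hVW).hom s := fun s => rfl
  let ΘR : Γ(↑chartA, W) ≃+* ↥E := Θ₀.symm.trans ΘV
  let pb : S → Γ(affineBlowup I₂, chartA) := fun f =>
    ((affineBlowup.π I₂).appLE ⊤ chartA hleπ (ι₀ f))
  have hpbΘ : ∀ f : S, ((ΘV (pb f) : ↥E) : S) = ψ₀ f := fun f => hΘV f
  -- the action on pull-backs: `(ρV g⁻¹)^* (π^* f) = π^* (g • f)`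
  have hst' : ∀ g : G, chartA ≤ (ρV g).hom ⁻¹ᵁ chartA := fun g => (hA_st g).ge
  have hpb_act : ∀ (g : G) (f : S),
      ((ρV g⁻¹).hom.appLE chartA chartA (hst' g⁻¹)).hom (pb f) = pb (g • f) := by
    intro g f
    have h := appLE_appLE_of_comp_eq (affineBlowup.π I₂) (ρV g⁻¹).hom (ρ g⁻¹).hom (hequiv g⁻¹)
      chartA (hst' g⁻¹) hleπ (ι₀ f)
    rw [specAction_appTop_ΓSpecIso_inv_smul ρ hρ f g⁻¹, inv_inv] at h
    exact h
  -- the action on `R₀` versus the action on `Γ(V, V[x_a])`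
  have hact : ∀ (g : G) (s : Γ(affineBlowup I₂, chartA)),
      ρO.act g ⊤ (Θ₀ s) = Θ₀ (((ρV g⁻¹).hom.appLE chartA chartA (hst' g⁻¹)).hom s) :=
    fun g s => restrict_act_appLE ρB chartA hOst hVW g s
  -- ### (3) the invariants of `R₀` are the cone algebra
  -- the transported endomorphism `τ = ΘR ∘ act σ ∘ ΘR⁻¹` of `E` obeys the root-substitution law
  let τ : ↥E →+* ↥E := (ΘR.toRingHom.comp (ρO.act gσ ⊤)).comp ΘR.symm.toRingHom
  have hτapp : ∀ x : Γ(↑chartA, W), τ (ΘR x) = ΘR (ρO.act gσ ⊤ x) := by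
    intro x
    change ΘR (ρO.act gσ ⊤ (ΘR.symm (ΘR x))) = _
    rw [RingEquiv.symm_apply_apply]
  have hΘR : ∀ s, ΘR (Θ₀ s) = ΘV s := by
    intro s
    change ΘV (Θ₀.symm (Θ₀ s)) = ΘV s
    rw [RingEquiv.symm_apply_apply]
  have hτ : ∀ f : S, ((τ ⟨ψ₀ f, rootSubst_mem_adjoin k n a b f⟩ : ↥E) : S) = ψ₀ (σ f) := by
    intro f
    have e1 : (⟨ψ₀ f, rootSubst_mem_adjoin k n a b f⟩ : ↥E) = ΘR (Θ₀ (pb f)) := by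
      rw [hΘR]; exact Subtype.ext (hpbΘ f).symm
    rw [e1, hτapp, hact, hpb_act, hgσ_smul, hΘR]
    exact hpbΘ (σ f)
  have hfix := fixedPoints_eq_of_rootSubst_law p hp hp3 k n σ a b c hab hbc hac hb hc hσ τ hτ
  have hinv_iff : ∀ x : Γ(↑chartA, W), x ∈ inv ↔ ρO.act gσ ⊤ x = x := by
    intro x
    refine (ρO.mem_invariantsRing_iff ⊤ x).trans ⟨fun h => h gσ, fun h g => ?_⟩
    obtain ⟨m, rfl⟩ := hGpow g
    change ρO.actHom ⊤ (gσ ^ m) x = x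
    rw [map_pow, RingHom.coe_pow]
    exact Function.iterate_fixed h m
  have hinv_iff' : ∀ x : Γ(↑chartA, W), x ∈ inv ↔ ((ΘR x : ↥E) : S) ∈ Ec := by
    intro x
    rw [hinv_iff]
    have h2 : ρO.act gσ ⊤ x = x ↔ τ (ΘR x) = ΘR x := by
      rw [hτapp]
      constructor
      · intro h; rw [h]
      · intro h; exact ΘR.injective h
    rw [h2]
    change ΘR x ∈ {e : ↥E | τ e = e} ↔ _
    rw [hfix]
    rfl
  -- `Φ : inv ≃ Ec` under `ΘR`, and the composite `f₂ : inv → S`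
  obtain ⟨Φ, hΦS⟩ := exists_ringEquiv_subring_subalgebra hle ΘR inv hinv_iff'
  have hΦ : ∀ x : inv, Subalgebra.inclusion hle (Φ x) = ΘR x.1 := fun x =>
    Subtype.ext ((Subalgebra.coe_inclusion hle (Φ x)).trans (hΦS x))
  have hev : ∀ x : inv, Ec.val (Φ x) = ((ΘR x.1 : ↥E) : S) := fun x => hΦS x
  let f₂ : ↥inv →+* S := ((E.val : ↥E →+* S).comp ΘR.toRingHom).comp inv.subtype
  have hf₂ : ∀ x : inv, f₂ x = ((ΘR x.1 : ↥E) : S) := fun x => rfl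
  -- ### (4) the vertex ideal, in `E`, in `R₀` and in `inv`
  let gA : ↥E := ⟨X a ^ 2, sq_a_mem_adjoin k n a b⟩
  let gAB : ↥E := ⟨X a * X b, mul_ab_mem_adjoin k n a b⟩
  let gB : ↥E := ⟨X b ^ 2, sq_b_mem_adjoin k n a b⟩
  let 𝔟 : Ideal ↥E := Ideal.span {gA, gAB, gB}
  -- the chart ratio `r = x_b² / x_a` on `V[x_a]`
  let rV : Γ(affineBlowup I₂, chartA) := ΘV.symm gB
  have hgA : ΘV (pb (X a)) = gA := Subtype.ext (by rw [hpbΘ, hψa])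
  have hgAB : ΘV (pb (X b)) = gAB := Subtype.ext (by rw [hpbΘ, hψb])
  have hgB : ΘV rV = gB := RingEquiv.apply_symm_apply ΘV gB
  have hrV : pb (X b ^ 2) = pb (X a) * rV := by
    apply ΘV.injective
    apply Subtype.ext
    rw [map_mul, Subalgebra.coe_mul, hgA, hgB, hpbΘ, map_pow, hψb]
    change (X a * X b) ^ 2 = X a ^ 2 * X b ^ 2
    ring
  -- `𝔞 = (π^* x_a, π^* x_b, r) = ΘR⁻¹ 𝔟 ⊆ R₀`
  let 𝔞 : Ideal Γ(↑chartA, W) := Ideal.map ΘR.symm 𝔟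
  have h𝔞c : 𝔞 = Ideal.comap ΘR 𝔟 := Ideal.map_symm ΘR
  have hΘRsymm : ∀ y : ↥E, ΘR.symm y = Θ₀ (ΘV.symm y) := fun y => rfl
  have e1 : ΘR.symm gA = Θ₀ (pb (X a)) := by
    rewrite [hΘRsymm, ← hgA, RingEquiv.symm_apply_apply]; rfl
  have e2 : ΘR.symm gAB = Θ₀ (pb (X b)) := by
    rewrite [hΘRsymm, ← hgAB, RingEquiv.symm_apply_apply]; rfl
  have e3 : ΘR.symm gB = Θ₀ rV := hΘRsymm gB
  have hgen : ∀ K : Ideal Γ(↑chartA, W),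
      𝔞 ≤ K ↔ Θ₀ (pb (X a)) ∈ K ∧ Θ₀ (pb (X b)) ∈ K ∧ Θ₀ rV ∈ K := fun K =>
    (map_symm_span_le_iff ΘR gA gAB gB K).trans (by simp only [e1, e2, e3])
  -- the presentation of the invariants by the cone quotient, vertex ideal to vertex ideal
  obtain ⟨Φ₂, hΦ₂⟩ := exists_coneQuotEquiv_map_vertex p hp hp3 k n a b c hab hbc hac
  let φ : (MvPolynomial (Option (Fin n)) k ⧸ Ideal.span
      {(X (some a) * X none - X (some b) ^ 2 : MvPolynomial (Option (Fin n)) k)}) ≃+* ↥inv :=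
    Φ₂.trans Φ.symm
  have hK𝔞 : Ideal.comap inv.subtype 𝔞 = Ideal.comap f₂ (Ideal.span {(X a : S), X b}) := by
    have h := comap_inclusion_span_sq_eq p hp hp3 k n a b c hab hbc hac
    ext x
    have e𝔞 : x ∈ Ideal.comap inv.subtype 𝔞 ↔ ΘR x.1 ∈ Ideal.span {gA, gAB, gB} := by
      rewrite [Ideal.mem_comap, h𝔞c]
      exact Iff.rfl
    have eJ : x ∈ Ideal.comap f₂ (Ideal.span {(X a : S), X b}) ↔
        ((ΘR x.1 : ↥E) : S) ∈ Ideal.span {(X a : S), X b} := by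
      rewrite [Ideal.mem_comap, hf₂]
      exact Iff.rfl
    have eΦ : Φ x ∈ Ideal.comap
        (Subalgebra.inclusion (adjoin_coneGens_le p hp hp3 k n a b c hab hbc hac))
        (Ideal.span {(⟨X a ^ 2, sq_a_mem_adjoin k n a b⟩ : ↥(Algebra.adjoin k (chartAGens k n a b))),
          ⟨X a * X b, mul_ab_mem_adjoin k n a b⟩, ⟨X b ^ 2, sq_b_mem_adjoin k n a b⟩}) ↔
        ΘR x.1 ∈ Ideal.span {gA, gAB, gB} :=
      Ideal.mem_comap.trans (Iff.of_eq (congrArg (fun y : ↥E => y ∈ Ideal.span {gA, gAB, gB})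
        (hΦ x)))
    have eΦ' : Φ x ∈ Ideal.comap (Algebra.adjoin k (coneGens k p n a b c)).val
        (Ideal.span {(X a : MvPolynomial (Fin n) k), X b}) ↔
        ((ΘR x.1 : ↥E) : S) ∈ Ideal.span {(X a : S), X b} :=
      Ideal.mem_comap.trans (Iff.of_eq (congrArg (fun y : S => y ∈ Ideal.span {(X a : S), X b})
        (hev x)))
    have hxh := SetLike.ext_iff.mp h (Φ x)
    exact e𝔞.trans ((eΦ.symm.trans (hxh.trans eΦ')).trans eJ.symm)
  have hKrad : (Ideal.comap f₂ (Ideal.span {(X a : S), X b})).IsRadical := by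
    have hprime : (Ideal.span {(X a : S), X b}).IsPrime := by
      have hval : Function.Injective
          (Subtype.val : {i : Fin n // i ∉ ({a, b} : Set (Fin n))} → Fin n) :=
        Subtype.val_injective
      have hker := Literature.AlgebraicGeometry.Resolution.MvPolynomial.ker_killCompl (R := k) hval
      rw [Literature.AlgebraicGeometry.Resolution.MvPolynomial.compl_range_val_not_mem,
        Set.image_insert_eq, Set.image_singleton] at hker
      rw [← hker]
      exact RingHom.ker_isPrime _
    exact (Ideal.comap_isPrime f₂ _).isRadical
  -- membership in `J = f₂⁻¹ (x_a, x_b)` through the cone presentation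
  have hJφ : ∀ x : ↥inv, x ∈ Ideal.comap f₂ (Ideal.span {(X a : S), X b}) ↔
      Φ₂.symm (Φ x) ∈ Ideal.map (Ideal.Quotient.mk (Ideal.span
        {(X (some a) * X none - X (some b) ^ 2 : MvPolynomial (Option (Fin n)) k)}))
        (Ideal.span {(X (some a) : MvPolynomial (Option (Fin n)) k), X (some b), X none}) := by
    intro x
    have e1 : x ∈ Ideal.comap f₂ (Ideal.span {(X a : S), X b}) ↔
        ((ΘR x.1 : ↥E) : S) ∈ Ideal.span {(X a : S), X b} := by
      rewrite [Ideal.mem_comap, hf₂]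
      exact Iff.rfl
    have e3 : Φ x ∈ Ideal.comap (Algebra.adjoin k (coneGens k p n a b c)).val
        (Ideal.span {(X a : MvPolynomial (Fin n) k), X b}) ↔
        ((ΘR x.1 : ↥E) : S) ∈ Ideal.span {(X a : S), X b} :=
      Ideal.mem_comap.trans (Iff.of_eq (congrArg (fun y : S => y ∈ Ideal.span {(X a : S), X b})
        (hev x)))
    have e4 := symm_mem_iff_of_map_eq Φ₂ _ _ hΦ₂ (Φ x)
    exact e1.trans (e3.symm.trans e4.symm)
  -- the blow-up of `Spec inv` along `J` is regular (C4, transported)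
  have hJreg : Scheme.IsRegular (affineBlowup (Ideal.comap f₂ (Ideal.span {(X a : S), X b}))) :=
    isRegular_affineBlowup_of_ringEquiv_mem φ _ _ (fun x => hJφ x)
      (JordanThree.cone_affineBlowup_isRegular k n a b hab)
  -- ### (5) the points: `e⁻¹ Za` is the zero locus of `J`
  -- integrality of `inv ⊆ R₀`; the vertex locus on `V[x_a]` (`mem_vertexLocus_iff`)
  have hint : (inv.subtype).IsIntegral := isIntegral_subtype_invariantsRing ρO ⊤
  have hpt_T := fun (v : ↑(affineBlowup I₂)) (hv : v ∈ chartA) =>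
    mem_vertexLocus_iff k n a b hO rV hrV v hv
  -- points of `W` and primes of `R₀`
  have hpt_W : ∀ (w : ↥W) (s : Γ(affineBlowup I₂, chartA)),
      Θ₀ s ∈ (hWaff.primeIdealOf w).asIdeal ↔
        s ∈ (hO.primeIdealOf ⟨chartA.ι.base w.1, hVW w.2⟩).asIdeal := by
    intro w s
    have h1 := IsAffineOpen.comap_primeIdealOf_appLE (f := chartA.ι) (x := w.1)
      chartA hO W hWaff hVW w.2
    have h2 : s ∈ Ideal.comap (chartA.ι.appLE chartA W hVW).hom (hWaff.primeIdealOf w).asIdeal ↔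
        s ∈ (hO.primeIdealOf ⟨chartA.ι.base w.1, hVW w.2⟩).asIdeal := by
      rw [← PrimeSpectrum.comap_asIdeal, h1]
    exact Ideal.mem_comap.symm.trans h2
  have hpt_𝔞 : ∀ w : ↥W, 𝔞 ≤ (hWaff.primeIdealOf w).asIdeal ↔
      chartA.ι.base w.1 ∈ ({v | (affineBlowup.π I₂).base v ∈
        PrimeSpectrum.zeroLocus (I₂ : Set S)} \ (chartB : Set ↑(affineBlowup I₂))) := by
    intro w
    rewrite [hgen, hpt_W, hpt_W, hpt_W, hpt_T _ (hVW w.2)]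
    exact Iff.rfl
  have hpt_mk : ∀ w : ↥W, (ρB.pieceMk Oa) ((W.ι) w) =
      e.hom ((Spec.map (CommRingCat.ofHom inv.subtype)) (W.toSpecΓ w)) := by
    intro w
    have h2 : (W.ι ≫ ρB.pieceMk Oa) w =
        (W.toSpecΓ ≫ Spec.map (CommRingCat.ofHom inv.subtype) ≫ e.hom) w := by
      rw [he]
      rfl
    simp only [Scheme.Hom.comp_apply] at h2
    exact h2
  have hprime : ∀ w : ↥W, W.toSpecΓ w = hWaff.primeIdealOf w := fun w => rfl
  have hcomap : ∀ 𝔮 : Spec Γ(↑chartA, W), (Spec.map (CommRingCat.ofHom inv.subtype)) 𝔮 =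
      PrimeSpectrum.comap inv.subtype 𝔮 := fun 𝔮 => rfl
  have hZset : ((Za.preimage e.hom.continuous : Closeds (Spec (CommRingCat.of ↥inv))) :
      Set (Spec (CommRingCat.of ↥inv))) =
      PrimeSpectrum.zeroLocus ((Ideal.comap f₂ (Ideal.span {(X a : S), X b}) : Ideal ↥inv) :
        Set ↥inv) := by
    rewrite [← hK𝔞, ← image_comap_zeroLocus_eq_of_isIntegral inv.subtype hint 𝔞,
      Closeds.coe_preimage, hZa]
    ext z
    constructor
    · rintro ⟨w₀, hw₀, hz⟩
      let w : ↥W := ⟨w₀, trivial⟩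
      have hzw : z = PrimeSpectrum.comap inv.subtype (hWaff.primeIdealOf w) := by
        apply e.hom.isOpenEmbedding.injective
        rw [← hz, ← hcomap, ← hprime, ← hpt_mk]
        rfl
      refine ⟨hWaff.primeIdealOf w, ?_, hzw.symm⟩
      rw [PrimeSpectrum.mem_zeroLocus, SetLike.coe_subset_coe]
      exact (hpt_𝔞 w).mpr hw₀
    · rintro ⟨𝔮, h𝔮, rfl⟩
      let w : ↥W := ⟨hWaff.fromSpec 𝔮, trivial⟩
      have hw : hWaff.primeIdealOf w = 𝔮 :=
        hWaff.fromSpec.isOpenEmbedding.injective (hWaff.fromSpec_primeIdealOf w)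
      rw [PrimeSpectrum.mem_zeroLocus, SetLike.coe_subset_coe, ← hw] at h𝔮
      refine ⟨w.1, (hpt_𝔞 w).mp h𝔮, ?_⟩
      change (ρB.pieceMk Oa) ((W.ι) w) = _
      rw [hpt_mk, hcomap, hprime, hw]
  -- ### (6) conclusion: transport the regular blow-up and use uniqueness of blow-ups
  have h𝓘 : (Scheme.IdealSheafData.vanishingIdeal Za).comap e.hom =
      affineBlowup.idealSheaf (Ideal.comap f₂ (Ideal.span {(X a : S), X b})) := by
    rw [comap_vanishingIdeal_of_isOpenImmersion]
    exact BlowupExit.vanishingIdeal_eq_idealSheaf_of_isRadical _ hKrad _ hZset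
  obtain ⟨B, pBl, hBl, hBreg⟩ := BlowupExit.exists_isBlowup_regular_of_iso_spec e
    (Scheme.IdealSheafData.vanishingIdeal Za) _ h𝓘 hJreg
  obtain ⟨e', -, -⟩ := hBl.unique hpB
  exact Scheme.IsRegular.of_iso e'.hom hBreg

end Summit.ResolutionOfSingularities.ResolutionOfSingularities.Theorems.WildQuotientResolution.ToricExit

end
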